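import Literature.Probability.LatticeModels.Sharpness
import Literature.Probability.LatticeModels.CorrelationInequalities
import Literature.Probability.LatticeModels.GibbsStates
import HarnessLib

/-!
# Continuity of the Ising magnetisation at `β_c`: the Aizenman–Duminil-Copin–Sidoravicius route

Trunk G02 (T-STATMECH), topic `Probability/LatticeModels`; namespaces `Literature.StatMech`
(definitions) and `Literature.CritIsing` (named facts and reductions). This file decomposes the named
fact `Literature.Probability.LatticeModels.spontaneousMagnetization_criticalBeta_eq_zero` of `Sharpness.lean`
(`m*(β_c) = 0` for the nearest-neighbour Ising model on `ℤ^d`, `d ≥ 3`) along the proof of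

* M. Aizenman, H. Duminil-Copin, V. Sidoravicius, *Random currents and continuity of Ising
  model's spontaneous magnetization*, Comm. Math. Phys. **334** (2015) 719–742
  (bib key `AizenmanDuminilCopinSidoraviciusCMP2015`, arXiv:1311.1937; below "ADS15"; **equation
  numbers are those of arXiv:1311.1937v3, the version held in the literature store — the journal
  numbering differs: `M_LRO` (1.8), `M̃_LRO` (1.9), the hypothesis `M̃_LRO(β_c) = 0` of Thm. 1.2
  (1.12), `E(p)` (1.17), `∫ dp/E(p) < ∞` (1.18), the Γ-bound (3.11), the FKG display (3.12), §3.3 =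
  (3.13)–(3.19); the Lebowitz–Martin-Löf criterion is Prop. B.1 of Appendix B**),

specialised throughout to the nearest-neighbour model on `ℤ^d` (which satisfies ADS15's standing
hypotheses C1–C4: translation invariant, ferromagnetic, finite range, aperiodic).

## Contents

Definitions (`Literature.StatMech`), all at zero magnetic field:

* `freePair d β x y = ⟨σ_x σ_y⟩^∅_{β,0}` and `plusPair d β x y = ⟨σ_x σ_y⟩⁺_{β,0}`, the two-site
  two-point functions of the free and plus states of the prelude (`freeExpect`, `plusExpect` of
  `spinPair x y`); on the first argument `0` they are the prelude's `twoPointFree`, `twoPointPlus`.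
* `freeBlockAverage d β B = |B|⁻² ∑_{x,y ∈ B} ⟨σ_x σ_y⟩^∅_β` (ADS15 §1.3, the quantity
  `⟨[|B|⁻¹ ∑_{x∈B} σ_x]²⟩^0_β`).
* `lroTildeSq d β = M̃_LRO(β)² = inf_{B finite nonempty} freeBlockAverage d β B` (ADS15 §1.3, (1.9)).
* `lroSq d β = M_LRO(β)² = lim_n |Λ_n|⁻¹ ∑_{x ∈ Λ_n} ⟨σ_0 σ_x⟩^∅_β` (ADS15 §1.3, (1.8)).

Named facts (`Literature.CritIsing`, `def … : Prop`, cited):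

* `spontaneousMagnetization_criticalBeta_eq_zero_of_lroTildeSq` — ADS15 Thm. 1.2, first
  assertion: `M̃_LRO(β_c) = 0 ⇒ m*(β_c) = 0`;
* `hasUniqueGibbsMeasure_criticalBeta_of_lroTildeSq` — ADS15 Thm. 1.2, second assertion:
  `M̃_LRO(β_c) = 0 ⇒` a unique Gibbs state at `β_c`;
* `lroTildeSq_criticalBeta_eq_zero` — ADS15 §3.3 (proof of Cor. 1.4, eqs. (3.13)–(3.19)) in
  case (1) of §1.4 / Cor. 1.5: for the nearest-neighbour model in `d > 2`, `M̃_LRO(β_c) = 0`;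
* the three ingredients of the last step of the proof of Thm. 1.2 (ADS15 §3.2, p. 731):
  `plusPair_eq_freePair_of_lroTildeSq` (Thm. 3.1 with Thm. 2.5 and eq. (3.11):
  `M̃_LRO(β) = 0 ⇒ ⟨σ_xσ_y⟩⁺_β = ⟨σ_xσ_y⟩^∅_β`), `plusExpect_spinAt_mul_le_plusPair` (FKG in the
  plus state, eq. (3.12)) and `plusExpect_spinAt_eq_spontaneousMagnetization` (translation
  invariance of `⟨σ_x⟩⁺`); and `hasUniqueGibbsMeasure_of_plusExpect_spinAt_eq_zero`
  (ADS15 Prop. B.1 (Appendix B), after Lebowitz–Martin-Löf 1972).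

Proved reductions:

* `spontaneousMagnetization_eq_zero_of_lroTildeSq_eq_zero` — the averaging argument closing
  ADS15 §3.2, at every `β ≥ 0`: the three ingredients give `m*(β)² ≤ freeBlockAverage d β B`
  for every nonempty `B`, hence `m*(β)² ≤ M̃_LRO(β)² = 0`;
* `spontaneousMagnetization_criticalBeta_eq_zero_of_lroTildeSq_of_ingredients`,
  `hasUniqueGibbsMeasure_criticalBeta_of_lroTildeSq_of_ingredients` — ADS15 Thm. 1.2 from the
  ingredients;
* `plusExpect_spinAt_mul_le_plusPair_of_fkg` — eq. (3.12) from the finite-volume FKG inequality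
  `ising_fkg` and the existence of the plus state `hasBoxLimit_isingCorr_plus` (tree facts);
* `plusExpect_spinAt_eq_spontaneousMagnetization_of_exists_plusMeasure` — translation
  invariance of `⟨σ_x⟩⁺` from `exists_plusMeasure` (tree fact);
* `spontaneousMagnetization_criticalBeta_eq_zero_of_ads`,
  `hasUniqueGibbsMeasure_criticalBeta_of_ads` — the target facts of `Sharpness.lean`
  (`spontaneousMagnetization_criticalBeta_eq_zero`, `hasUniqueGibbsMeasure_criticalBeta`) from
  ADS15 Thm. 1.2 and `lroTildeSq_criticalBeta_eq_zero`.

## Design and faithfulness notes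

* All infinite-volume quantities are the prelude's `limUnder` values along boxes (junk if the
  box limit does not exist; existence is the tree fact `hasBoxLimit_isingCorr_plus_free`).
  `lroTildeSq` is a real `sInf`; the defining set is bounded below (by `0`, first Griffiths
  inequality in the limit) but this is not needed for the reductions proved here, which only use
  `le_csInf`. `lroSq` is a `limUnder` (ADS15: "the limit existing by monotonicity arguments").
* ADS15 Thm. 1.2 is stated for coupling constants satisfying C1–C4 on `ℤ^d`; it is vendored for
  the nearest-neighbour model and `2 ≤ d` (the prelude's `criticalBeta d` is junk for `d ≤ 1`,
  where there is no transition; ADS15's `β_c` is then infinite and the statement is moot).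
  The §3.2 ingredients are vendored at every `β ≥ 0`, as proved there.
* `lroTildeSq_criticalBeta_eq_zero` carries `3 ≤ d`: ADS15 derive `M̃_LRO(β_c) = 0` from the
  infrared bound under condition (1.18), `∫ dp / E(p) < ∞`, which for the nearest-neighbour
  model (`E(p) ≈ |p|²`, §1.4) holds iff `d > 2`.
* The target `spontaneousMagnetization_criticalBeta_eq_zero` (`Sharpness.lean`) is NOT
  mis-stated: for the nearest-neighbour model in `d ≥ 3` it is exactly ADS15 Cor. 1.5 (1) with
  Thm. 1.2 (ADS15 footnote 2: `m*` is right-continuous, so continuity at `β_c` is `m*(β_c) = 0`).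

## Mathlib status

Mathlib has no Ising model, Gibbs state or long-range order parameter (searched `Ising`,
`longRangeOrder`, `magnetization`). Anchors used: `sInf`/`le_csInf` on `ℝ`, `Filter.limUnder`,
`Filter.Tendsto.limUnder_eq`, `MeasureTheory.integral_map_equiv`, `le_of_tendsto_of_tendsto'`.
-/

noncomputable section

open MeasureTheory Filter Topology Finset Literature.Probability.LatticeModels Literature.Probability.Percolation

namespace Literature.Probability.LatticeModels

variable (d : ℕ)

/-! ### Two-site two-point functions, block averages and the LRO parameters -/

/-- The free-state pair correlation at zero field, `⟨σ_x σ_y⟩^∅_{β,0}` on `ℤ^d`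
(nearest-neighbour model): the prelude's free state `freeExpect` (a `limUnder` along boxes,
junk if divergent) of the pair observable `σ_x σ_y` (so `= 1` for `x = y`).
(ADS15 §1.1 and §1.3, `⟨σ_xσ_y⟩⁰_β`; Friedli–Velenik 2017, §3.7.4.) [cite: AizenmanDuminilCopinSidoraviciusCMP2015, §1.1 and §1.3] -/
def freePair (β : ℝ) (x y : Site d) : ℝ :=
  freeExpect d β 0 (spinPair x y)

/-- The plus-state pair correlation at zero field, `⟨σ_x σ_y⟩⁺_{β,0}` on `ℤ^d`: the prelude's
plus state `plusExpect` (a `limUnder` along boxes) of `σ_x σ_y`.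
(ADS15 §1.1, `⟨σ_xσ_y⟩⁺_β`; Friedli–Velenik 2017, §3.7.4.) [cite: AizenmanDuminilCopinSidoraviciusCMP2015, §1.1] -/
def plusPair (β : ℝ) (x y : Site d) : ℝ :=
  plusExpect d β 0 (spinPair x y)

/-- On the first argument `0`, `freePair` is the prelude's `twoPointFree` (by definition).
(Friedli–Velenik 2017, §3.7.4.) [cite: FriedliVelenik2017, §3.7.4] -/
@[simp] theorem freePair_zero_left (β : ℝ) (x : Site d) :
    freePair d β 0 x = twoPointFree d β x := rfl

/-- On the first argument `0`, `plusPair` is the prelude's `twoPointPlus` (by definition).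
(Friedli–Velenik 2017, §3.7.4.) [cite: FriedliVelenik2017, §3.7.4] -/
@[simp] theorem plusPair_zero_left (β : ℝ) (x : Site d) :
    plusPair d β 0 x = twoPointPlus d β x := rfl

/-- A finite-volume expectation of a constant observable is that constant (the Gibbs measure is
a probability measure). Elementary. [folklore] -/
theorem isingExpect_const {V : Type*} (G : SimpleGraph V) [DecidableEq V] [G.LocallyFinite]
    (Λ : Finset V) (β h : ℝ) (bc : BoundaryCondition V) (c : ℝ) :
    isingExpect G Λ β h bc (fun _ => c) = c := by
  simp [isingExpect]

/-- The diagonal of the free pair correlation is `1`: `⟨σ_x σ_x⟩^∅ = ⟨1⟩ = 1` (the box sequence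
is constant, so the `limUnder` is a genuine limit). (ADS15 §1.3; Friedli–Velenik 2017, §3.2.) [cite: FriedliVelenik2017, §3.2] -/
@[simp] theorem freePair_self (β : ℝ) (x : Site d) : freePair d β x x = 1 := by
  simp only [freePair, freeExpect, spinPair_self, isingExpect_const]
  exact tendsto_const_nhds.limUnder_eq

/-- The diagonal of the plus pair correlation is `1`: `⟨σ_x σ_x⟩⁺ = 1`.
(Friedli–Velenik 2017, §3.2.) [cite: FriedliVelenik2017, §3.2] -/
@[simp] theorem plusPair_self (β : ℝ) (x : Site d) : plusPair d β x x = 1 := by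
  simp only [plusPair, plusExpect, spinPair_self, isingExpect_const]
  exact tendsto_const_nhds.limUnder_eq

/-- The block average of the free two-point function over a finite set `B ⊂ ℤ^d`,
`|B|⁻² ∑_{x,y ∈ B} ⟨σ_x σ_y⟩^∅_β = ⟨[|B|⁻¹ ∑_{x ∈ B} σ_x]²⟩^∅_β` (ADS15 §1.3, the second form of the definition of `M̃_LRO`). Junk value
`0` for `B = ∅` (division convention). [cite: AizenmanDuminilCopinSidoraviciusCMP2015, §1.3] -/
def freeBlockAverage (β : ℝ) (B : Finset (Site d)) : ℝ :=
  (∑ x ∈ B, ∑ y ∈ B, freePair d β x y) / ((#B : ℝ) ^ 2)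

/-- Unfolding of `freeBlockAverage`. (ADS15 §1.3.) [cite: AizenmanDuminilCopinSidoraviciusCMP2015, §1.3] -/
theorem freeBlockAverage_def (β : ℝ) (B : Finset (Site d)) :
    freeBlockAverage d β B = (∑ x ∈ B, ∑ y ∈ B, freePair d β x y) / ((#B : ℝ) ^ 2) := rfl

/-- The block average over a singleton is `⟨σ_x σ_x⟩ = 1`. (ADS15 §1.3.) [cite: AizenmanDuminilCopinSidoraviciusCMP2015, §1.3] -/
@[simp] theorem freeBlockAverage_singleton (β : ℝ) (x : Site d) :
    freeBlockAverage d β {x} = 1 := by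
  simp [freeBlockAverage]

/-- The (variant) long-range order parameter squared,
`M̃_LRO(β)² = inf_{B ⊂ ℤ^d, 0 < |B| < ∞} |B|⁻² ∑_{x,y ∈ B} ⟨σ_x σ_y⟩^∅_β` (ADS15 §1.3), as
a real `sInf` over nonempty finite `B`. The defining set is nonempty; it is bounded below by `0`
(first Griffiths inequality in the infinite-volume limit), which is not proved here — for a set
unbounded below `Real.sInf` would return the junk value `0`. [cite: AizenmanDuminilCopinSidoraviciusCMP2015, §1.3] -/
def lroTildeSq (β : ℝ) : ℝ :=
  sInf (freeBlockAverage d β '' {B : Finset (Site d) | B.Nonempty})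

/-- The long-range order parameter squared,
`M_LRO(β)² = lim_{n → ∞} |Λ_n|⁻¹ ∑_{x ∈ Λ_n} ⟨σ_0 σ_x⟩^∅_β`, `Λ_n = [-n,n]^d` (ADS15 §1.3:
"the limit existing by monotonicity arguments"), as a `limUnder` (**junk-valued** if the sequence
diverged). [cite: AizenmanDuminilCopinSidoraviciusCMP2015, §1.3, eq. (1.8)] -/
def lroSq (β : ℝ) : ℝ :=
  limUnder atTop fun n : ℕ => (∑ x ∈ box d n, twoPointFree d β x) / (#(box d n) : ℝ)

/-- The defining set of `M̃_LRO(β)²` is nonempty (e.g. `B = {0}` contributes `1`).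
(ADS15 §1.3.) [cite: AizenmanDuminilCopinSidoraviciusCMP2015, §1.3] -/
theorem lroTildeSq_set_nonempty (β : ℝ) :
    (freeBlockAverage d β '' {B : Finset (Site d) | B.Nonempty}).Nonempty :=
  ⟨_, ⟨{0}, Finset.singleton_nonempty 0, rfl⟩⟩

/-- A lower bound of all block averages over nonempty finite sets is a lower bound of
`M̃_LRO(β)²` (`le_csInf`; no boundedness hypothesis needed). (ADS15 §1.3.) [cite: AizenmanDuminilCopinSidoraviciusCMP2015, §1.3] -/
theorem le_lroTildeSq {β a : ℝ}
    (h : ∀ B : Finset (Site d), B.Nonempty → a ≤ freeBlockAverage d β B) :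
    a ≤ lroTildeSq d β :=
  le_csInf (lroTildeSq_set_nonempty d β) (by rintro _ ⟨B, hB, rfl⟩; exact h B hB)

/-- If the block averages are bounded below (e.g. by `0`, GKS I), `M̃_LRO(β)²` is at most each of
them (`csInf_le`); this is the direction used in ADS15 §3.3, eq. (3.19). [cite: AizenmanDuminilCopinSidoraviciusCMP2015, §1.3 and §3.3, eq. (3.19)] -/
theorem lroTildeSq_le {β : ℝ}
    (hbdd : BddBelow (freeBlockAverage d β '' {B : Finset (Site d) | B.Nonempty}))
    {B : Finset (Site d)} (hB : B.Nonempty) :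
    lroTildeSq d β ≤ freeBlockAverage d β B :=
  csInf_le hbdd ⟨B, hB, rfl⟩

end Literature.Probability.LatticeModels

namespace Literature.Probability.LatticeModels

variable {d : ℕ}

/-! ### ADS15 Theorem 1.2 and the reflection-positivity input (§3.3), as named facts -/

/-- **ADS15 Theorem 1.2, first assertion** (Aizenman–Duminil-Copin–Sidoravicius, CMP 334
(2015), Thm. 1.2), for the nearest-neighbour Ising model on `ℤ^d`, `d ≥ 2` (which satisfies the
standing hypotheses C1–C4 of ADS15 §1.1): if `M̃_LRO(β_c) = 0` (the hypothesis (1.12) of Thm. 1.2) then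
`m*(β_c) = 0`. (`2 ≤ d` excludes the prelude's junk `β_c = 0` in `d ≤ 1`, where there is no
transition.) [cite: AizenmanDuminilCopinSidoraviciusCMP2015, Thm. 1.2] -/
def spontaneousMagnetization_criticalBeta_eq_zero_of_lroTildeSq : Prop :=
  2 ≤ d → lroTildeSq d (criticalBeta d) = 0 → spontaneousMagnetization d (criticalBeta d) = 0

/-- **ADS15 Theorem 1.2, second assertion** (Aizenman–Duminil-Copin–Sidoravicius, CMP 334
(2015), Thm. 1.2), nearest-neighbour Ising model on `ℤ^d`, `d ≥ 2`: if `M̃_LRO(β_c) = 0` then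
the system has only one Gibbs state at `β_c` (zero field). [cite: AizenmanDuminilCopinSidoraviciusCMP2015, Thm. 1.2] -/
def hasUniqueGibbsMeasure_criticalBeta_of_lroTildeSq : Prop :=
  2 ≤ d → lroTildeSq d (criticalBeta d) = 0 →
    HasUniqueGibbsMeasure (isingSpecification (zdGraph d) (criticalBeta d) 0)

/-- **ADS15 §3.3** (Aizenman–Duminil-Copin–Sidoravicius, CMP 334 (2015), proof of Cor. 1.4,
eqs. (3.13)–(3.19), last paragraph of §3.3: "if Condition (1.18) holds, then `M̃_LRO(β_c) = 0`",
applied to case (1) of §1.4 / Cor. 1.5: the nearest-neighbour model is reflection positive and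
`E(p) ≈ |p|²`, so (1.18) `∫ dp/E(p) < ∞` holds iff `d > 2`). For the nearest-neighbour Ising
model on `ℤ^d`, `d ≥ 3`: `M̃_LRO(β_c)² = 0`. (Inputs of the printed proof: the infrared bound
(Prop. 1.3), Griffiths' inequalities, and finiteness of the susceptibility below `β_c`,
Aizenman–Barsky–Fernández 1987.) [cite: AizenmanDuminilCopinSidoraviciusCMP2015, §3.3, eqs. (3.13)–(3.19)] -/
def lroTildeSq_criticalBeta_eq_zero : Prop :=
  3 ≤ d → lroTildeSq d (criticalBeta d) = 0

/-! ### The ingredients of the last step of the proof of Theorem 1.2 (ADS15 §3.2) -/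

/-- **ADS15 §3.2, consequence of Thm. 3.1, Thm. 2.5 and eq. (3.11)** (Aizenman–Duminil-Copin–
Sidoravicius, CMP 334 (2015), §3.2: "Applying Theorem 3.1 we conclude that
`ℙ_β[x ↔ ∞] = 0`, and hence for any `x, y ∈ ℤ^d`: `⟨σ_xσ_y⟩⁺ = ⟨σ_xσ_y⟩⁰`"; Thm. 3.1:
`M̃_LRO(β) = 0 ⇒ ℙ_β[0 ↔ ∞] = 0`; eq. (3.11):
`0 ≤ ⟨σ_xσ_y⟩⁺_β - ⟨σ_xσ_y⟩⁰_β ≤ Γ_{x,y}⁻¹ ℙ_β[x ↔ ∞]`). For the nearest-neighbour Ising model on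
`ℤ^d` at `β ≥ 0`: if `M̃_LRO(β)² = 0` then the plus and free pair correlations coincide,
`⟨σ_x σ_y⟩⁺_{β,0} = ⟨σ_x σ_y⟩^∅_{β,0}` for all `x, y`. (This is the random-current heart of ADS15:
infinite-volume random currents, uniqueness of the infinite cluster, switching lemma.) [cite: AizenmanDuminilCopinSidoraviciusCMP2015, §3.2, Thm. 3.1 and eq. (3.11)] -/
def plusPair_eq_freePair_of_lroTildeSq : Prop :=
  ∀ ⦃β : ℝ⦄, 0 ≤ β → lroTildeSq d β = 0 → ∀ x y : Site d, plusPair d β x y = freePair d β x y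

/-- **ADS15 eq. (3.12), FKG in the plus state** (Aizenman–Duminil-Copin–Sidoravicius, CMP 334
(2015), eq. (3.12): "using the FKG inequality [FKG71] … `0 ≤ ⟨σ_0⟩⁺⟨σ_x⟩⁺ ≤ ⟨σ_0σ_y⟩⁺`";
Fortuin–Kasteleyn–Ginibre, CMP 22 (1971)). For the nearest-neighbour Ising model on `ℤ^d` at
`β ≥ 0` and zero field, `⟨σ_x⟩⁺_β ⟨σ_y⟩⁺_β ≤ ⟨σ_x σ_y⟩⁺_β` for all `x, y` (`σ_x`, `σ_y` are
increasing; finite-volume FKG passes to the box limit). Proved below from the tree facts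
`ising_fkg` and `hasBoxLimit_isingCorr_plus` (`plusExpect_spinAt_mul_le_plusPair_of_fkg`). [cite: AizenmanDuminilCopinSidoraviciusCMP2015, eq. (3.12)] -/
def plusExpect_spinAt_mul_le_plusPair : Prop :=
  ∀ ⦃β : ℝ⦄, 0 ≤ β → ∀ x y : Site d,
    plusExpect d β 0 (spinAt x) * plusExpect d β 0 (spinAt y) ≤ plusPair d β x y

/-- **Translation invariance of the plus-state magnetisation** (ADS15 §3.2, last sentence:
"for translation invariant models `m*(β_c) = 0` implies that `⟨σ_x⟩⁺_{β_c} = 0` for all sites";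
Friedli–Velenik 2017, Thm. 3.17 (translation invariance of `⟨·⟩⁺`)). For the nearest-neighbour
Ising model on `ℤ^d` at `β ≥ 0` and zero field, `⟨σ_x⟩⁺_β = ⟨σ_0⟩⁺_β = m*(β)` for every `x`.
Proved below from the tree fact `exists_plusMeasure`
(`plusExpect_spinAt_eq_spontaneousMagnetization_of_exists_plusMeasure`). [cite: FriedliVelenik2017, Thm. 3.17] -/
def plusExpect_spinAt_eq_spontaneousMagnetization : Prop :=
  ∀ ⦃β : ℝ⦄, 0 ≤ β → ∀ x : Site d, plusExpect d β 0 (spinAt x) = spontaneousMagnetization d β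

/-- **ADS15 Proposition B.1 (Appendix B), (a) ⇒ (b)** (Aizenman–Duminil-Copin–Sidoravicius, CMP
334 (2015), Prop. B.1, after Lebowitz–Martin-Löf, CMP 25 (1972) 276: in a ferromagnetic Ising model with
pair interactions and `∑_y J_{x,y} < ∞`, at `h = 0` and `β₀ ≥ 0`, "(a) for all `x`:
`⟨σ_x⟩⁺_{β₀} = 0`" is equivalent to "(b) there is a unique Gibbs state at `β₀`" (and continuity
of the state); vendored: (a) ⇒ uniqueness). For the nearest-neighbour Ising model on `ℤ^d`:
if `⟨σ_x⟩⁺_{β,0} = 0` for all `x` then the Ising specification at `(β, 0)` has exactly one Gibbs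
measure. [cite: AizenmanDuminilCopinSidoraviciusCMP2015, Prop. B.1 (Appendix B)] -/
def hasUniqueGibbsMeasure_of_plusExpect_spinAt_eq_zero : Prop :=
  ∀ ⦃β : ℝ⦄, 0 ≤ β → (∀ x : Site d, plusExpect d β 0 (spinAt x) = 0) →
    HasUniqueGibbsMeasure (isingSpecification (zdGraph d) β 0)

/-! ### Proved reductions -/

/-- **The averaging step of ADS15 §3.2** (Aizenman–Duminil-Copin–Sidoravicius, CMP 334 (2015),
p. 731, eq. (3.12) and the following sentence), at an arbitrary `β ≥ 0`: if plus and free pair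
correlations coincide whenever `M̃_LRO(β) = 0` (Thm. 3.1 + (3.11)), FKG (3.12) holds and `⟨σ_x⟩⁺`
is translation invariant, then `M̃_LRO(β)² = 0 ⇒ m*(β) = 0`. Proof: `m*(β)² = ⟨σ_x⟩⁺⟨σ_y⟩⁺ ≤
⟨σ_xσ_y⟩⁺ = ⟨σ_xσ_y⟩⁰` for all `x, y`; averaging over `x, y ∈ B` gives
`m*(β)² ≤ |B|⁻² ∑_{x,y∈B} ⟨σ_xσ_y⟩⁰` for every nonempty finite `B`, hence
`m*(β)² ≤ M̃_LRO(β)² = 0`. [cite: AizenmanDuminilCopinSidoraviciusCMP2015, §3.2, eq. (3.12)] -/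
theorem spontaneousMagnetization_eq_zero_of_lroTildeSq_eq_zero
    (h31 : plusPair_eq_freePair_of_lroTildeSq (d := d))
    (hfkg : plusExpect_spinAt_mul_le_plusPair (d := d))
    (hti : plusExpect_spinAt_eq_spontaneousMagnetization (d := d))
    {β : ℝ} (hβ : 0 ≤ β) (h0 : lroTildeSq d β = 0) :
    spontaneousMagnetization d β = 0 := by
  set m := spontaneousMagnetization d β with hm
  -- `m² ≤ ⟨σ_x σ_y⟩⁰_β` for all `x, y`
  have hxy : ∀ x y : Site d, m * m ≤ freePair d β x y := fun x y => by
    have h := hfkg hβ x y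
    rwa [hti hβ x, hti hβ y, h31 hβ h0 x y] at h
  -- hence `m² ≤` every block average
  have hB : ∀ B : Finset (Site d), B.Nonempty → m * m ≤ freeBlockAverage d β B := by
    intro B hBne
    have hcard : (0 : ℝ) < #B := by exact_mod_cast hBne.card_pos
    rw [freeBlockAverage_def, le_div_iff₀ (by positivity)]
    calc m * m * (#B : ℝ) ^ 2 = ∑ x ∈ B, ∑ y ∈ B, m * m := by
          simp only [sum_const]; ring
      _ ≤ ∑ x ∈ B, ∑ y ∈ B, freePair d β x y :=
          sum_le_sum fun x _ => sum_le_sum fun y _ => hxy x y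
  have hle : m * m ≤ lroTildeSq d β := le_lroTildeSq d hB
  rw [h0] at hle
  exact mul_self_eq_zero.1 (le_antisymm hle (mul_self_nonneg m))

/-- **ADS15 Theorem 1.2, first assertion, from the §3.2 ingredients**: the named fact
`spontaneousMagnetization_criticalBeta_eq_zero_of_lroTildeSq` follows from
`plusPair_eq_freePair_of_lroTildeSq` (Thm. 3.1 + Thm. 2.5 + (3.11)), FKG (3.12) and translation
invariance, by `spontaneousMagnetization_eq_zero_of_lroTildeSq_eq_zero` at `β = β_c ≥ 0`.
(Aizenman–Duminil-Copin–Sidoravicius, CMP 334 (2015), §3.2.) [cite: AizenmanDuminilCopinSidoraviciusCMP2015, Thm. 1.2 and §3.2] -/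
theorem spontaneousMagnetization_criticalBeta_eq_zero_of_lroTildeSq_of_ingredients
    (h31 : plusPair_eq_freePair_of_lroTildeSq (d := d))
    (hfkg : plusExpect_spinAt_mul_le_plusPair (d := d))
    (hti : plusExpect_spinAt_eq_spontaneousMagnetization (d := d)) :
    spontaneousMagnetization_criticalBeta_eq_zero_of_lroTildeSq (d := d) :=
  fun _ h0 =>
    spontaneousMagnetization_eq_zero_of_lroTildeSq_eq_zero h31 hfkg hti (criticalBeta_nonneg d) h0

/-- **ADS15 Theorem 1.2, second assertion, from the ingredients**: with Prop. B.1 in addition,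
`M̃_LRO(β_c) = 0` gives `m*(β_c) = 0`, hence `⟨σ_x⟩⁺_{β_c} = 0` for all `x` (translation
invariance), hence uniqueness of the Gibbs state at `β_c`.
(Aizenman–Duminil-Copin–Sidoravicius, CMP 334 (2015), end of §3.2.) [cite: AizenmanDuminilCopinSidoraviciusCMP2015, Thm. 1.2, §3.2 and Prop. B.1] -/
theorem hasUniqueGibbsMeasure_criticalBeta_of_lroTildeSq_of_ingredients
    (h31 : plusPair_eq_freePair_of_lroTildeSq (d := d))
    (hfkg : plusExpect_spinAt_mul_le_plusPair (d := d))
    (hti : plusExpect_spinAt_eq_spontaneousMagnetization (d := d))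
    (h51 : hasUniqueGibbsMeasure_of_plusExpect_spinAt_eq_zero (d := d)) :
    hasUniqueGibbsMeasure_criticalBeta_of_lroTildeSq (d := d) := by
  intro _ h0
  have hm : spontaneousMagnetization d (criticalBeta d) = 0 :=
    spontaneousMagnetization_eq_zero_of_lroTildeSq_eq_zero h31 hfkg hti (criticalBeta_nonneg d) h0
  exact h51 (criticalBeta_nonneg d) fun x => (hti (criticalBeta_nonneg d) x).trans hm

/-- **crit-ising.S09 from ADS15**: the target fact `spontaneousMagnetization_criticalBeta_eq_zero`
of `Sharpness.lean` (`m*(β_c) = 0` for `d ≥ 3`) follows from ADS15 Thm. 1.2 (first assertion)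
and the reflection-positivity input `lroTildeSq_criticalBeta_eq_zero` (ADS15 §3.3, `d > 2`).
This is ADS15 Cor. 1.5 (1) for the nearest-neighbour model.
(Aizenman–Duminil-Copin–Sidoravicius, CMP 334 (2015), Cor. 1.5 (1).) [cite: AizenmanDuminilCopinSidoraviciusCMP2015, Cor. 1.5 (1)] -/
theorem spontaneousMagnetization_criticalBeta_eq_zero_of_ads
    (h12 : spontaneousMagnetization_criticalBeta_eq_zero_of_lroTildeSq (d := d))
    (h33 : lroTildeSq_criticalBeta_eq_zero (d := d)) :
    spontaneousMagnetization_criticalBeta_eq_zero (d := d) :=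
  fun hd => h12 (le_trans (by norm_num) hd) (h33 hd)

/-- **crit-ising.S09 (uniqueness) from ADS15**: the fact `hasUniqueGibbsMeasure_criticalBeta`
of `Sharpness.lean` (a unique Gibbs measure at `(β_c, 0)` for `d ≥ 3`) follows from ADS15
Thm. 1.2 (second assertion) and `lroTildeSq_criticalBeta_eq_zero`.
(Aizenman–Duminil-Copin–Sidoravicius, CMP 334 (2015), Thm. 1.2 with Cor. 1.5 (1).) [cite: AizenmanDuminilCopinSidoraviciusCMP2015, Thm. 1.2 with Cor. 1.5 (1)] -/
theorem hasUniqueGibbsMeasure_criticalBeta_of_ads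
    (h12 : hasUniqueGibbsMeasure_criticalBeta_of_lroTildeSq (d := d))
    (h33 : lroTildeSq_criticalBeta_eq_zero (d := d)) :
    hasUniqueGibbsMeasure_criticalBeta (d := d) :=
  fun hd => h12 (le_trans (by norm_num) hd) (h33 hd)

/-! ### Discharging two ingredients from tree facts -/

/-- The plus state of a single spin is the box limit of the finite-volume plus expectations
(unpacking the tree fact `hasBoxLimit_isingCorr_plus` at `A = {x}`, `spinProduct {x} = σ_x`).
(Friedli–Velenik 2017, Thm. 3.17.) [cite: FriedliVelenik2017, Thm. 3.17] -/
theorem tendsto_isingExpect_plus_spinAt (hlim : hasBoxLimit_isingCorr_plus d) {β : ℝ}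
    (hβ : 0 ≤ β) (x : Site d) :
    Tendsto (fun L : ℕ => isingExpect (zdGraph d) (box d L) β 0 .plus (spinAt x)) atTop
      (𝓝 (plusExpect d β 0 (spinAt x))) := by
  have hs : spinProduct ({x} : Finset (Site d)) = spinAt x := by
    funext s; simp [spinProduct]
  have h := hlim hβ le_rfl {x}
  simpa only [HasBoxLimit, isingCorr, plusCorr, hs] using h

/-- The plus pair correlation is the box limit of the finite-volume plus expectations of
`σ_x σ_y` (tree fact `hasBoxLimit_isingCorr_plus` at `A = {x, y}` for `x ≠ y`; constant sequence
`1` for `x = y`). (Friedli–Velenik 2017, Thm. 3.17.) [cite: FriedliVelenik2017, Thm. 3.17] -/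
theorem tendsto_isingExpect_plus_spinPair (hlim : hasBoxLimit_isingCorr_plus d) {β : ℝ}
    (hβ : 0 ≤ β) (x y : Site d) :
    Tendsto (fun L : ℕ => isingExpect (zdGraph d) (box d L) β 0 .plus (spinPair x y)) atTop
      (𝓝 (plusPair d β x y)) := by
  rcases eq_or_ne x y with rfl | hxy
  · simp only [spinPair_self, isingExpect_const, plusPair_self]
    exact tendsto_const_nhds
  · have hs : spinProduct ({x, y} : Finset (Site d)) = spinPair x y := by
      funext s; simp [spinProduct, spinPair, Finset.prod_pair hxy]
    have h := hlim hβ le_rfl {x, y}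
    simpa only [HasBoxLimit, isingCorr, plusCorr, plusPair, hs] using h

/-- **ADS15 eq. (3.12) discharged from tree facts**: the finite-volume FKG inequality `ising_fkg`
(for the increasing observables `σ_x`, `σ_y`, product `σ_x σ_y`) and the existence of the plus
state `hasBoxLimit_isingCorr_plus` give `⟨σ_x⟩⁺⟨σ_y⟩⁺ ≤ ⟨σ_xσ_y⟩⁺` in the box limit.
(Aizenman–Duminil-Copin–Sidoravicius, CMP 334 (2015), eq. (3.12); Fortuin–Kasteleyn–Ginibre 1971.) [cite: AizenmanDuminilCopinSidoraviciusCMP2015, eq. (3.12)] -/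
theorem plusExpect_spinAt_mul_le_plusPair_of_fkg
    (hfkg : ∀ β : ℝ, ising_fkg (zdGraph d) (β := β))
    (hlim : hasBoxLimit_isingCorr_plus d) :
    plusExpect_spinAt_mul_le_plusPair (d := d) := by
  intro β hβ x y
  have hx := tendsto_isingExpect_plus_spinAt hlim hβ x
  have hy := tendsto_isingExpect_plus_spinAt hlim hβ y
  have hp := tendsto_isingExpect_plus_spinPair hlim hβ x y
  refine le_of_tendsto_of_tendsto' (hx.mul hy) hp fun L => ?_
  have hmul : spinAt x * spinAt y = spinPair x y := rfl
  have h := hfkg β hβ (box d L) 0 .plus (spinAt x) (spinAt y) (spinAt_mono x) (spinAt_mono y)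
    (measurable_spinAt x) (measurable_spinAt y)
  rwa [hmul] at h

/-- **Translation invariance of `⟨σ_x⟩⁺` discharged from a tree fact**: `exists_plusMeasure`
provides a translation-invariant measure `μ⁺` with `spinCorr μ⁺ A = plusCorr d β 0 A`; then
`⟨σ_x⟩⁺ = ∫ σ_x dμ⁺ = ∫ σ_x d(θ_x μ⁺) = ∫ σ_0 dμ⁺ = ⟨σ_0⟩⁺ = m*(β)`.
(Friedli–Velenik 2017, Thm. 3.17; Georgii 2011, Ch. 5, (5.3)–(5.4).) [cite: FriedliVelenik2017, Thm. 3.17] -/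
theorem plusExpect_spinAt_eq_spontaneousMagnetization_of_exists_plusMeasure
    (hplus : ∀ β : ℝ, exists_plusMeasure d (β := β) 0) :
    plusExpect_spinAt_eq_spontaneousMagnetization (d := d) := by
  intro β hβ x
  obtain ⟨μ, -, hti, hcorr⟩ := hplus β hβ
  have hs : ∀ z : Site d, spinProduct ({z} : Finset (Site d)) = spinAt z := fun z => by
    funext s; simp [spinProduct]
  -- `⟨σ_z⟩⁺ = ∫ σ_z dμ` for every `z`
  have hz : ∀ z : Site d, plusExpect d β 0 (spinAt z) = ∫ s, spinAt z s ∂μ := fun z => by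
    have h := hcorr {z}
    simp only [spinCorr, plusCorr, hs] at h
    exact h.symm
  rw [spontaneousMagnetization, hz x, hz 0]
  -- translation invariance: `∫ σ_x dμ = ∫ σ_x d(θ_x μ) = ∫ σ_0 dμ`
  conv_lhs => rw [← hti x]
  rw [integral_map_equiv]
  refine integral_congr_ae (Eventually.of_forall fun s => ?_)
  simp [spinAt, configShift_apply]

end Literature.Probability.LatticeModels
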